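import Literature.Geometry.DiscreteGeometry.KissingTriangleDeficit
import HarnessLib

/-!
# A kissing configuration of Hales's class `𝒱` has at least `23` contacts
# (Hales 2012, proof of Theorem 3: the weight count behind the face and edge bounds)

Topic `Literature/Geometry/DiscreteGeometry`; provefact brick for `Hales2012_contactGraphTame`,
assembling `KissingFacetPenaltyRefined.lean` (budget: `Σ fanPenaltyLB₂ ≤ 4π − 20 sol₀`),
`KissingFanCensus.lean` (`Σ (3 − r) = 60 − 2·#contacts`), `KissingEdgeDeficit.lean` and
`KissingTriangleDeficit.lean` (deficit/supply of the fan triangles; `0.103 · units ≤ penalty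
bound`).  Hales bounds the total weight `Σ_F τ(F) = 4π − 20 sol₀ < tgt = 1.541` and reads off
the combinatorics of the contact graph (faces of size `≤ 8`, node degrees, Lemma 6, Theorem 3);
the first such consequence, proved here at the level of the Delaunay facets and without the
hypermap language, is a lower bound on the number of contact edges:

* Part A (polygon sides, per facet): the deficits of the fan triangles whose very long side is a
  side of the facet polygon are at most the `edgeDeficit`s of the facet, and the `edgeSupply`s of
  the facet are at most the corresponding supplies (`sum_polyDeficit_le`, `sum_edgeSupply_le`).
* Part B: **`sum_sum_fanDeficit_le`** (`Σ deficit ≤ Σ supply` over all fan triangles, from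
  Part A with `sum_sum_edgeDeficit_le`, and `sum_diagDeficit_le` for the diagonals), hence
  `sum_sum_fanUnits_ge`: `Σ units ≥ 60 − 2 · #contacts`.
* Part C: `lt_hales_sol0` (`sol₀ > 0.5475`), `budget_lt` (`4π − 20 sol₀ < 1.62`) and the census
  **`twentythree_le_card_contactPairsAt`**: twelve unit vectors whose distinct pairs have inner
  product `1/2` or `≤ κ₀` have at least `23` contact pairs (`0.103 · 16 = 1.648 > 1.62`);
  `IsKissingConfig.twentythree_le`: every `V ∈ 𝒱` has at least `23` contact pairs (in `V/2`).
  FCC and HCP have `24`; with Lemma 7 (`IsKissingConfig.card_edgeFinset_le`,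
  `KissingNodeDegree.lean`: at most `24`) this is Hales's census `#E₂(V) ∈ {23, 24}` behind the
  face counts of the eight tame-contact hypermaps (`13` or `14` faces).

Everything is PROVED; no named facts.  Not here: the classification (Lemma 8) and the linear
programs (Lemma 9, in the tree for the eight graphs).

## References
* T. C. Hales, arXiv:1209.6043 (2012): proof of Theorem 2 (superadditivity), Lemmas 4–6,
  Theorem 3 and its proof ("`Σ_F τ(V,E₂(V),F) = 4π − 20 sol₀ < tgt`"). [`Hales2012`]
-/

noncomputable section

namespace Literature.Geometry.DiscreteGeometry

open Real RealInnerProductSpace Finset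

section ContactCount

local notation "E3" => EuclideanSpace ℝ (Fin 3)

variable {X : Finset E3}

/-! ### Part A. Polygon sides: fan-triangle deficits vs. `edgeDeficit`, `edgeSupply` vs. supplies -/

/-- Sums over the hull edges of a facet are sums over the index of the polygon side.
[folklore] -/
theorem sum_edgesOfFacet_eq_sum_range (hX1 : ∀ y ∈ X, ‖y‖ = 1)
    (h0 : (0 : E3) ∈ interior (convexHull ℝ (X : Set E3))) {c : E3} (hc : c ∈ facetNormals X)
    (F : Finset E3 → ℝ) :
    ∑ e ∈ edgesOfFacet X c, F e = ∑ j ∈ range (tightSet X c).card,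
      F {fVert X c j, fVert X c ((j + 1) % (tightSet X c).card)} := by
  classical
  set hc0 := ne_zero_of_mem_facetNormals hX1 hc
  set m := (facetAngles X c hc0).card with hm
  have hmt : (tightSet X c).card = m := (card_facetAngles hX1 hc0).symm
  set g : ℕ → Finset E3 := fun j =>
    ({facetVertex X c hc0 j, facetVertex X c hc0 ((j + 1) % m)} : Finset E3) with hg
  have himg : edgesOfFacet X c = (range m).image g := edgesOfFacet_eq_image hX1 h0 hc
  have hinj : Set.InjOn g (range m : Set ℕ) := by
    have hcard : ((range m).image g).card = (range m).card := by
      rw [← himg, card_edgesOfFacet hX1 h0 hc, hmt, card_range]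
    exact Finset.card_image_iff.1 hcard
  rw [himg, Finset.sum_image hinj, hmt]
  refine Finset.sum_congr rfl fun j _ => ?_
  rw [fVert_eq hc0, fVert_eq hc0]

variable (hX1 : ∀ y ∈ X, ‖y‖ = 1) {c : E3} (hc : c ∈ facetNormals X)
include hX1 hc

/-- An apex over the polygon side `{w (i+1), w (i+2)}` of the `i`-th fan triangle: `w 0`, when
its two other sides are contacts. [folklore] -/
theorem hasApex_side_x {i : ℕ} (hi : i + 2 < (tightSet X c).card) (hy : cy X c i = 1 / 2)
    (hz : cz X c i = 1 / 2) : HasApex X c {fVert X c (i + 1), fVert X c (i + 2)} := by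
  refine ⟨fVert X c 0, fVert_mem_tightSet_of_lt hX1 hc (by omega), ?_, ?_⟩
  · rw [mem_insert, mem_singleton, not_or]
    exact ⟨fVert_ne_of_ne hX1 hc (by omega) (by omega) (by omega),
      fVert_ne_of_ne hX1 hc (by omega) hi (by omega)⟩
  · intro y hy'
    rw [mem_insert, mem_singleton] at hy'
    rcases hy' with rfl | rfl
    · exact hz
    · exact hy

/-- An apex over the polygon side `{w (m−1), w 0}` (last fan triangle): `w (m−2)`. [folklore] -/
theorem hasApex_side_y (hx : cx X c ((tightSet X c).card - 3) = 1 / 2)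
    (hz : cz X c ((tightSet X c).card - 3) = 1 / 2) :
    HasApex X c {fVert X c ((tightSet X c).card - 1), fVert X c 0} := by
  set m := (tightSet X c).card with hm
  have hm3 : 3 ≤ m := three_le_card_tightSet hc
  unfold cx at hx; unfold cz at hz
  rw [show m - 3 + 1 = m - 2 by omega] at hx hz
  rw [show m - 3 + 2 = m - 1 by omega] at hx
  refine ⟨fVert X c (m - 2), fVert_mem_tightSet_of_lt hX1 hc (by omega), ?_, ?_⟩
  · rw [mem_insert, mem_singleton, not_or]
    exact ⟨fVert_ne_of_ne hX1 hc (by omega) (by omega) (by omega),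
      fVert_ne_of_ne hX1 hc (by omega) (by omega) (by omega)⟩
  · intro y hy'
    rw [mem_insert, mem_singleton] at hy'
    rcases hy' with rfl | rfl
    · exact hx
    · rw [real_inner_comm]; exact hz

/-- An apex over the polygon side `{w 0, w 1}` (first fan triangle): `w 2`. [folklore] -/
theorem hasApex_side_z (hx : cx X c 0 = 1 / 2) (hy : cy X c 0 = 1 / 2) :
    HasApex X c {fVert X c 0, fVert X c 1} := by
  have hm3 : 3 ≤ (tightSet X c).card := three_le_card_tightSet hc
  unfold cx at hx; unfold cy at hy
  refine ⟨fVert X c 2, fVert_mem_tightSet_of_lt hX1 hc (by omega), ?_, ?_⟩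
  · rw [mem_insert, mem_singleton, not_or]
    exact ⟨fVert_ne_of_ne hX1 hc (by omega) (by omega) (by omega),
      fVert_ne_of_ne hX1 hc (by omega) (by omega) (by omega)⟩
  · intro y hy'
    rw [mem_insert, mem_singleton] at hy'
    rcases hy' with rfl | rfl
    · rw [real_inner_comm]; exact hy
    · rw [real_inner_comm]; exact hx

omit hX1 hc in
/-- `contactCount` is symmetric (the two transpositions used below). [folklore] -/
theorem contactCount_perm (x y z : ℝ) :
    contactCount x y z = contactCount y x z ∧ contactCount x y z = contactCount z x y := by
  unfold contactCount; constructor <;> ring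

omit hX1 hc in
/-- An indicator is below `edgeDeficit` when it implies its condition. [folklore] -/
theorem ite_le_edgeDeficit {P : Prop} [Decidable P] {e : Finset E3}
    (h : P → IsVeryLong e ∧ HasApex X c e) : (if P then (1 : ℝ) else 0) ≤ edgeDeficit X c e := by
  unfold edgeDeficit
  by_cases hP : P
  · rw [if_pos hP, if_pos (h hP)]
  · rw [if_neg hP]; split_ifs <;> norm_num

omit hX1 hc in
/-- `edgeSupply` is below an indicator whose condition it implies. [folklore] -/
theorem edgeSupply_le_ite {P : Prop} [Decidable P] {e : Finset E3}
    (h : IsVeryLong e → ¬HasApex X c e → P) : edgeSupply X c e ≤ (if P then (1 : ℝ) else 0) := by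
  unfold edgeSupply
  by_cases hc' : IsVeryLong e ∧ ¬HasApex X c e
  · rw [if_pos hc', if_pos (h hc'.1 hc'.2)]
  · rw [if_neg hc']; split_ifs <;> norm_num

/-- **The polygon-side deficits of a facet are at most its `edgeDeficit`s.**
[cite: Hales2012, proof of Theorem 2 (superadditivity of d₃)] -/
theorem sum_polyDeficit_le (h0 : (0 : E3) ∈ interior (convexHull ℝ (X : Set E3))) :
    (∑ i ∈ range ((tightSet X c).card - 2),
        (if fanContacts X c i = 2 ∧ cx X c i < 0 then (1 : ℝ) else 0)) +
      (if fanContacts X c ((tightSet X c).card - 3) = 2 ∧ cy X c ((tightSet X c).card - 3) < 0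
        then (1 : ℝ) else 0) +
      (if fanContacts X c 0 = 2 ∧ cz X c 0 < 0 then (1 : ℝ) else 0) ≤
    ∑ e ∈ edgesOfFacet X c, edgeDeficit X c e := by
  set m := (tightSet X c).card with hm
  have hm3 : 3 ≤ m := three_le_card_tightSet hc
  rw [sum_edgesOfFacet_eq_sum_range hX1 h0 hc]
  obtain ⟨n, hn⟩ : ∃ n, m = n + 3 := ⟨m - 3, by omega⟩
  rw [← hm, hn, show n + 3 - 2 = n + 1 by omega, show n + 3 - 3 = n by omega]
  have hlast : (n + 2 + 1) % (n + 3) = 0 := by rw [show n + 2 + 1 = n + 3 by ring, Nat.mod_self]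
  have hfirst : (0 + 1) % (n + 3) = 1 := Nat.mod_eq_of_lt (by omega)
  conv_rhs => rw [sum_range_succ, sum_range_succ', hlast, hfirst]
  -- the three groups of terms
  have hA : ∑ i ∈ range (n + 1), (if fanContacts X c i = 2 ∧ cx X c i < 0 then (1 : ℝ) else 0) ≤
      ∑ i ∈ range (n + 1), edgeDeficit X c {fVert X c (i + 1), fVert X c ((i + 1 + 1) % (n + 3))} := by
    refine Finset.sum_le_sum fun i hi => ?_
    have him := mem_range.1 hi
    rw [show (i + 1 + 1) % (n + 3) = i + 2 from Nat.mod_eq_of_lt (by omega)]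
    refine ite_le_edgeDeficit fun ⟨h2, hx⟩ => ⟨isVeryLong_pair_iff.2 hx, ?_⟩
    rw [fanContacts_eq] at h2
    obtain ⟨hy, hz⟩ := (eq_half_of_contactCount_eq_two h2).1 hx
    exact hasApex_side_x hX1 hc (by omega) hy hz
  have hB : (if fanContacts X c n = 2 ∧ cy X c n < 0 then (1 : ℝ) else 0) ≤
      edgeDeficit X c {fVert X c (n + 2), fVert X c 0} := by
    refine ite_le_edgeDeficit fun ⟨h2, hy⟩ => ⟨?_, ?_⟩
    · refine isVeryLong_pair_iff.2 ?_
      unfold cy at hy; rw [real_inner_comm]; exact hy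
    · rw [fanContacts_eq] at h2
      obtain ⟨hx, hz⟩ := (eq_half_of_contactCount_eq_two h2).2.1 hy
      have := hasApex_side_y hX1 hc (by rw [← hm, hn]; exact hx) (by rw [← hm, hn]; exact hz)
      rw [← hm, hn, show n + 3 - 1 = n + 2 by omega] at this
      exact this
  have hC : (if fanContacts X c 0 = 2 ∧ cz X c 0 < 0 then (1 : ℝ) else 0) ≤
      edgeDeficit X c {fVert X c 0, fVert X c 1} := by
    refine ite_le_edgeDeficit fun ⟨h2, hz⟩ => ⟨isVeryLong_pair_iff.2 hz, ?_⟩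
    rw [fanContacts_eq] at h2
    obtain ⟨hx, hy⟩ := (eq_half_of_contactCount_eq_two h2).2.2 hz
    exact hasApex_side_z hX1 hc hx hy
  linarith

/-- **The `edgeSupply`s of a facet are at most its polygon-side supplies.**
[cite: Hales2012, proof of Theorem 2 (superadditivity of d₃)] -/
theorem sum_edgeSupply_le (h0 : (0 : E3) ∈ interior (convexHull ℝ (X : Set E3))) :
    ∑ e ∈ edgesOfFacet X c, edgeSupply X c e ≤
      (∑ i ∈ range ((tightSet X c).card - 2),
          (if fanContacts X c i ≤ 1 ∧ cx X c i < 0 then (1 : ℝ) else 0)) +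
        (if fanContacts X c ((tightSet X c).card - 3) ≤ 1 ∧ cy X c ((tightSet X c).card - 3) < 0
          then (1 : ℝ) else 0) +
        (if fanContacts X c 0 ≤ 1 ∧ cz X c 0 < 0 then (1 : ℝ) else 0) := by
  set m := (tightSet X c).card with hm
  have hm3 : 3 ≤ m := three_le_card_tightSet hc
  rw [sum_edgesOfFacet_eq_sum_range hX1 h0 hc]
  obtain ⟨n, hn⟩ : ∃ n, m = n + 3 := ⟨m - 3, by omega⟩
  rw [← hm, hn, show n + 3 - 2 = n + 1 by omega, show n + 3 - 3 = n by omega]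
  have hlast : (n + 2 + 1) % (n + 3) = 0 := by rw [show n + 2 + 1 = n + 3 by ring, Nat.mod_self]
  have hfirst : (0 + 1) % (n + 3) = 1 := Nat.mod_eq_of_lt (by omega)
  conv_lhs => rw [sum_range_succ, sum_range_succ', hlast, hfirst]
  have hA : ∑ i ∈ range (n + 1), edgeSupply X c {fVert X c (i + 1), fVert X c ((i + 1 + 1) % (n + 3))}
      ≤ ∑ i ∈ range (n + 1), (if fanContacts X c i ≤ 1 ∧ cx X c i < 0 then (1 : ℝ) else 0) := by
    refine Finset.sum_le_sum fun i hi => ?_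
    have him := mem_range.1 hi
    rw [show (i + 1 + 1) % (n + 3) = i + 2 from Nat.mod_eq_of_lt (by omega)]
    refine edgeSupply_le_ite fun hvl hna => ?_
    have hx : cx X c i < 0 := isVeryLong_pair_iff.1 hvl
    refine ⟨?_, hx⟩
    by_contra hgt
    have hge : 2 ≤ contactCount (cx X c i) (cy X c i) (cz X c i) := by
      rw [← fanContacts_eq]; omega
    obtain ⟨hy, hz⟩ := eq_half_of_two_le_contactCount hge (fun e => by rw [e] at hx; norm_num at hx)
    exact hna (hasApex_side_x hX1 hc (by omega) hy hz)
  have hB : edgeSupply X c {fVert X c (n + 2), fVert X c 0} ≤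
      (if fanContacts X c n ≤ 1 ∧ cy X c n < 0 then (1 : ℝ) else 0) := by
    refine edgeSupply_le_ite fun hvl hna => ?_
    have hy : cy X c n < 0 := by
      have := isVeryLong_pair_iff.1 hvl
      unfold cy; rw [real_inner_comm]; exact this
    refine ⟨?_, hy⟩
    by_contra hgt
    have hge : 2 ≤ contactCount (cy X c n) (cx X c n) (cz X c n) := by
      rw [← (contactCount_perm _ _ _).1, ← fanContacts_eq]; omega
    obtain ⟨hx, hz⟩ := eq_half_of_two_le_contactCount hge (fun e => by rw [e] at hy; norm_num at hy)
    have := hasApex_side_y hX1 hc (by rw [← hm, hn]; exact hx) (by rw [← hm, hn]; exact hz)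
    rw [← hm, hn, show n + 3 - 1 = n + 2 by omega] at this
    exact hna this
  have hC : edgeSupply X c {fVert X c 0, fVert X c 1} ≤
      (if fanContacts X c 0 ≤ 1 ∧ cz X c 0 < 0 then (1 : ℝ) else 0) := by
    refine edgeSupply_le_ite fun hvl hna => ?_
    have hz : cz X c 0 < 0 := isVeryLong_pair_iff.1 hvl
    refine ⟨?_, hz⟩
    by_contra hgt
    have hge : 2 ≤ contactCount (cz X c 0) (cx X c 0) (cy X c 0) := by
      rw [← (contactCount_perm _ _ _).2, ← fanContacts_eq]; omega
    obtain ⟨hx, hy⟩ := eq_half_of_two_le_contactCount hge (fun e => by rw [e] at hz; norm_num at hz)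
    exact hna (hasApex_side_z hX1 hc hx hy)
  linarith

/-! ### Part B. `Σ deficit ≤ Σ supply` over all fan triangles, and the units -/

omit hX1 in
/-- Per facet, the deficits split into polygon-side and diagonal parts. [folklore] -/
theorem sum_fanDeficit_eq :
    ∑ i ∈ range ((tightSet X c).card - 2), fanDeficit X c i =
      ((∑ i ∈ range ((tightSet X c).card - 2),
          (if fanContacts X c i = 2 ∧ cx X c i < 0 then (1 : ℝ) else 0)) +
        (if fanContacts X c ((tightSet X c).card - 3) = 2 ∧ cy X c ((tightSet X c).card - 3) < 0
          then (1 : ℝ) else 0) +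
        (if fanContacts X c 0 = 2 ∧ cz X c 0 < 0 then (1 : ℝ) else 0)) +
      ((∑ i ∈ range ((tightSet X c).card - 3),
          (if fanContacts X c i = 2 ∧ cy X c i < 0 then (1 : ℝ) else 0)) +
        (∑ i ∈ Ico 1 ((tightSet X c).card - 2),
          (if fanContacts X c i = 2 ∧ cz X c i < 0 then (1 : ℝ) else 0))) := by
  set m := (tightSet X c).card with hm
  have hm3 : 3 ≤ m := three_le_card_tightSet hc
  rw [Finset.sum_congr rfl fun i _ => fanDeficit_eq_sum X c i, sum_add_distrib, sum_add_distrib]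
  have hB : ∑ i ∈ range (m - 2), (if fanContacts X c i = 2 ∧ cy X c i < 0 then (1 : ℝ) else 0) =
      (∑ i ∈ range (m - 3), (if fanContacts X c i = 2 ∧ cy X c i < 0 then (1 : ℝ) else 0)) +
        (if fanContacts X c (m - 3) = 2 ∧ cy X c (m - 3) < 0 then (1 : ℝ) else 0) := by
    rw [show m - 2 = m - 3 + 1 by omega, sum_range_succ]
  have hC : ∑ i ∈ range (m - 2), (if fanContacts X c i = 2 ∧ cz X c i < 0 then (1 : ℝ) else 0) =
      (if fanContacts X c 0 = 2 ∧ cz X c 0 < 0 then (1 : ℝ) else 0) +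
        ∑ i ∈ Ico 1 (m - 2), (if fanContacts X c i = 2 ∧ cz X c i < 0 then (1 : ℝ) else 0) := by
    rw [show m - 2 = m - 3 + 1 by omega, sum_range_succ', Finset.sum_Ico_eq_sum_range,
      show m - 3 + 1 - 1 = m - 3 by omega, add_comm]
    congr 1
    exact Finset.sum_congr rfl fun i _ => by rw [add_comm 1 i]
  rw [hB, hC]
  ring

omit hX1 in
/-- Per facet, the supplies split into polygon-side and diagonal parts. [folklore] -/
theorem sum_fanSupply_eq :
    ∑ i ∈ range ((tightSet X c).card - 2), fanSupply X c i =
      ((∑ i ∈ range ((tightSet X c).card - 2),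
          (if fanContacts X c i ≤ 1 ∧ cx X c i < 0 then (1 : ℝ) else 0)) +
        (if fanContacts X c ((tightSet X c).card - 3) ≤ 1 ∧ cy X c ((tightSet X c).card - 3) < 0
          then (1 : ℝ) else 0) +
        (if fanContacts X c 0 ≤ 1 ∧ cz X c 0 < 0 then (1 : ℝ) else 0)) +
      ((∑ i ∈ Ico 1 ((tightSet X c).card - 2),
          (if fanContacts X c i ≤ 1 ∧ cz X c i < 0 then (1 : ℝ) else 0)) +
        (∑ i ∈ range ((tightSet X c).card - 3),
          (if fanContacts X c i ≤ 1 ∧ cy X c i < 0 then (1 : ℝ) else 0))) := by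
  set m := (tightSet X c).card with hm
  have hm3 : 3 ≤ m := three_le_card_tightSet hc
  rw [Finset.sum_congr rfl fun i _ => fanSupply_eq_sum X c i, sum_add_distrib, sum_add_distrib]
  have hB : ∑ i ∈ range (m - 2), (if fanContacts X c i ≤ 1 ∧ cy X c i < 0 then (1 : ℝ) else 0) =
      (∑ i ∈ range (m - 3), (if fanContacts X c i ≤ 1 ∧ cy X c i < 0 then (1 : ℝ) else 0)) +
        (if fanContacts X c (m - 3) ≤ 1 ∧ cy X c (m - 3) < 0 then (1 : ℝ) else 0) := by
    rw [show m - 2 = m - 3 + 1 by omega, sum_range_succ]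
  have hC : ∑ i ∈ range (m - 2), (if fanContacts X c i ≤ 1 ∧ cz X c i < 0 then (1 : ℝ) else 0) =
      (if fanContacts X c 0 ≤ 1 ∧ cz X c 0 < 0 then (1 : ℝ) else 0) +
        ∑ i ∈ Ico 1 (m - 2), (if fanContacts X c i ≤ 1 ∧ cz X c i < 0 then (1 : ℝ) else 0) := by
    rw [show m - 2 = m - 3 + 1 by omega, sum_range_succ', Finset.sum_Ico_eq_sum_range,
      show m - 3 + 1 - 1 = m - 3 by omega, add_comm]
    congr 1
    exact Finset.sum_congr rfl fun i _ => by rw [add_comm 1 i]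
  rw [hB, hC]
  ring

omit hc in
/-- **`Σ deficit ≤ Σ supply` over all fan triangles of all facets.**
[cite: Hales2012, proof of Theorem 2 (superadditivity of d₃)] -/
theorem sum_sum_fanDeficit_le (h0 : (0 : E3) ∈ interior (convexHull ℝ (X : Set E3))) :
    ∑ c ∈ facetNormals X, ∑ i ∈ range ((tightSet X c).card - 2), fanDeficit X c i ≤
      ∑ c ∈ facetNormals X, ∑ i ∈ range ((tightSet X c).card - 2), fanSupply X c i := by
  have hE := sum_sum_edgeDeficit_le hX1 h0
  rw [Finset.sum_congr rfl fun c hc => sum_fanDeficit_eq (c := c) hc,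
    Finset.sum_congr rfl fun c hc => sum_fanSupply_eq (c := c) hc]
  have h1 := Finset.sum_le_sum fun c hc => sum_polyDeficit_le hX1 (c := c) hc h0
  have h2 := Finset.sum_le_sum fun c hc => sum_edgeSupply_le hX1 (c := c) hc h0
  have h3 := Finset.sum_le_sum fun c hc => sum_diagDeficit_le hX1 (c := c) hc
  simp only [sum_add_distrib] at h1 h2 h3 ⊢
  linarith

end ContactCount

/-! ### Part C. The census: at least `22` contact pairs -/

section Census

local notation "E3" => EuclideanSpace ℝ (Fin 3)

variable {X : Finset E3}

/-- **`Σ units ≥ 60 − 2·#contacts`.** [cite: Hales2012, proof of Theorem 3] -/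
theorem sum_sum_fanUnits_ge (h12 : X.card = 12) (hX1 : ∀ y ∈ X, ‖y‖ = 1)
    (hp : ∀ y ∈ X, ∀ y' ∈ X, y ≠ y' → ⟪y, y'⟫ ≤ 1 / 2) :
    60 - 2 * ((contactPairsAt X (1 / 2)).card : ℝ) ≤
      ∑ c ∈ facetNormals X, ∑ i ∈ range ((tightSet X c).card - 2), fanUnits X c i := by
  have h0 := zero_mem_interior_convexHull_of_twelve_unit h12 hX1 hp
  have hcen := sum_sum_three_sub_fanContacts h12 hX1 hp
  have hdef := sum_sum_fanDeficit_le hX1 h0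
  simp only [fanUnits_eq, sum_sub_distrib, sum_add_distrib] at hcen ⊢
  linarith

/-- **`sol₀ > 0.5475`** (`cos 0.5475 ≥ 2(1 − 0.5475²/8)² − 1 > 23/27`). [folklore] -/
theorem lt_hales_sol0 : 0.5475 < hales_sol0 := by
  rw [hales_sol0_eq_arccos]
  have h1 : 1 - (0.5475 / 2) ^ 2 / 2 ≤ cos ((0.5475 : ℝ) / 2) := one_sub_sq_div_two_le_cos
  have hnn : (0 : ℝ) ≤ 1 - (0.5475 / 2) ^ 2 / 2 := by norm_num
  have h2 : (1 - (0.5475 / 2) ^ 2 / 2) ^ 2 ≤ cos ((0.5475 : ℝ) / 2) ^ 2 := pow_le_pow_left₀ hnn h1 2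
  have h3 : cos (0.5475 : ℝ) = 2 * cos ((0.5475 : ℝ) / 2) ^ 2 - 1 := by
    rw [cos_sq, mul_div_cancel₀ (0.5475 : ℝ) two_ne_zero]; ring
  have hcos : (23 : ℝ) / 27 < cos 0.5475 := by rw [h3]; nlinarith
  have harc : arccos (cos (0.5475 : ℝ)) = 0.5475 :=
    arccos_cos (by norm_num) (by linarith [pi_gt_three])
  rw [← harc]
  exact arccos_lt_arccos (by norm_num) hcos (cos_le_one _)

/-- **The budget is `< 1.62`** (`4π − 20 sol₀ ≈ 1.5407`). [cite: Hales2012, Lemma 5] -/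
theorem budget_lt : 4 * π - 20 * hales_sol0 < 1.62 := by
  have hπ := pi_lt_d6
  have hs := lt_hales_sol0
  norm_num at hπ hs ⊢
  linarith

/-- **Twelve unit vectors whose distinct pairs have inner product `1/2` or `≤ κ₀` have at least
`23` contact pairs** (`0.103 (60 − 2c) ≤ Σ 0.103·units ≤ Σ fanPenaltyLB₂ ≤ 4π − 20 sol₀ < 1.62`,
and `0.103 · 16 > 1.62`). [cite: Hales2012, proof of Theorem 3 (weights)] -/
theorem twentythree_le_card_contactPairsAt (h12 : X.card = 12) (hX1 : ∀ y ∈ X, ‖y‖ = 1)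
    (hV : ∀ y ∈ X, ∀ y' ∈ X, y ≠ y' → ⟪y, y'⟫ = 1 / 2 ∨ ⟪y, y'⟫ ≤ 1031 / 5000) :
    23 ≤ (contactPairsAt X (1 / 2)).card := by
  have hp : ∀ y ∈ X, ∀ y' ∈ X, y ≠ y' → ⟪y, y'⟫ ≤ 1 / 2 := fun y hy y' hy' h =>
    (hV y hy y' hy' h).elim le_of_eq fun h' => by linarith
  have hU := sum_sum_fanUnits_ge h12 hX1 hp
  have hB := sum_sum_fanPenaltyLB₂_le h12 hX1 hV
  have hcmp : ∑ c ∈ facetNormals X, ∑ i ∈ range ((tightSet X c).card - 2), 0.103 * fanUnits X c i ≤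
      ∑ c ∈ facetNormals X, ∑ i ∈ range ((tightSet X c).card - 2), fanPenaltyLB₂ X c i :=
    Finset.sum_le_sum fun c _ => Finset.sum_le_sum fun i _ => mul_fanUnits_le_fanPenaltyLB₂ X c i
  rw [Finset.sum_congr rfl fun c _ => (Finset.mul_sum _ _ _).symm, ← Finset.mul_sum] at hcmp
  have hlt := budget_lt
  have hreal : (23 : ℝ) ≤ (contactPairsAt X (1 / 2)).card := by
    by_contra hcon
    push Not at hcon
    have h22 : ((contactPairsAt X (1 / 2)).card : ℝ) ≤ 22 := by
      have : (contactPairsAt X (1 / 2)).card ≤ 22 := by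
        by_contra h; push Not at h
        have : (23 : ℝ) ≤ (contactPairsAt X (1 / 2)).card := by exact_mod_cast h
        linarith
      exact_mod_cast this
    norm_num at hcmp hlt
    nlinarith
  exact_mod_cast hreal

variable {S : Set E3}

/-- **Every `V ∈ 𝒱` has at least `23` contact pairs** (counted in `V/2`; at most `24` by
Lemma 7, `IsKissingConfig.card_edgeFinset_le`). [cite: Hales2012, proof of Theorem 3 (weights)] -/
theorem IsKissingConfig.twentythree_le (hS : IsKissingConfig S) :
    23 ≤ (contactPairsAt hS.unitConfig (1 / 2)).card :=
  twentythree_le_card_contactPairsAt hS.card_unitConfig (fun _ hy => hS.norm_of_mem_unitConfig hy)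
    fun _ hy _ hy' hne => hS.inner_of_mem_unitConfig hy hy' hne

end Census

end Literature.Geometry.DiscreteGeometry

end
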